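import Mathlib
import HarnessLib
import Literature.Analysis.FluidPDE.SuitableWeak
import Literature.Analysis.FluidPDE.SelfSimilar
import Literature.Analysis.FluidPDE.LocalTypeI
import Summits.NavierStokesRegularity.NavierStokesRegularity.Theorems.RellichScarApexLocalisationRussianDoll
import Summits.NavierStokesRegularity.NavierStokesRegularity.Theorems.RellichScarApexLocalisationWeakL3Reduction
import Summits.NavierStokesRegularity.NavierStokesRegularity.Theses.RellichScar

/-!
# Skeleton — crux `ApexLocalisation` (stmt-NavierStokesRegularity-11719), line `Sketch`
# (= idea `russian-doll-multiplicity`, crux-ideate r2 k5), lead c5 — skeleton v3 (FINAL: one sorry = the bet)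

`ApexLocalisation_of` proves
`Summit.NavierStokesRegularity.NavierStokesRegularity.Theses.RellichScar.ApexLocalisation` from the ONE
remaining registered stub, the bet `stub_weakL3Selection`, through the LANDED certificate
`stub_rdCruxIffWeakL3Selection : ApexLocalisation ↔ WeakL3Selection`
(Theorems/RellichScarApexLocalisationWeakL3Reduction.lean, p128744), whose `⇐` direction is the LANDED
Russian-doll theorem `stub_rdWeakL3Localisation` (Theorems/RellichScarApexLocalisationRussianDoll.lean,
p128653) = composition of the landed stubs

* S1 `stub_rdSingularLump`  (…RdSingularLump.lean, p127864)  — singular point ⇒ lump;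
* S2 `stub_rdSatelliteLump` (…RdSatelliteLump.lean, p128188) — blowing-up satellite ⇒ lump;
* S3 `stub_rdLocalApex`     (…RdLocalApex.lean, p127889)     — locally apex at a singular point ⇒ apex singular profile;
* S4 `stub_rdTower`         (…RdTower.lean, p128357)         — the doll induction T(m);
* S5 `stub_rdCount`         (…RdCount.lean, p127947)         — Tonelli + weak-L³ slice bound;
* S6 `stub_rdNormalise`     (…RdNormalise.lean, p127933)     — continuous representative + rescaling.

v1 (7 stub sorries + REAL glue `rd_weakL3Localisation`) and v2 are superseded; the glue now lives in the tree.
-/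

noncomputable section

set_option linter.dupNamespace false

namespace Summit.NavierStokesRegularity.NavierStokesRegularity.Theorems.RellichScarApexLocalisation

open MeasureTheory Set Function Metric Filter Topology TopologicalSpace
open scoped ENNReal NNReal
open Literature.Analysis Literature.Analysis.FluidPDE

local notation "E³" => EuclideanSpace ℝ (Fin 3)

/-- The open backward slab `(-∞, 0) × ℝ³` (time first). -/
local notation "𝕊" => Literature.Analysis.FluidPDE.slab (EuclideanSpace ℝ (Fin 3)) (Set.Iio (0 : ℝ)) isOpen_Iio

/-! ### S7 — THE BET: weak-`L³` selection (the only open stub; crux-EQUIVALENT) -/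

/-- **S7 (stub_weakL3Selection) — THE BET** (∃-form class change; crux-EQUIVALENT by the landed certificate
`stub_rdCruxIffWeakL3Selection`).  If a rate-Type-I singular slab profile with `𝐈 < ⊤` exists, then one
exists whose slices are uniformly in weak-`L³` (`h³ |{‖u(t)‖ > h}| ≤ M`) — a blow-up profile of bounded lump
multiplicity, the Choe–Wolf–Yang / Barker class.  Open (its failure for every profile is the Type-I
Cantor-dust scenario; no Navier–Stokes input bounding simultaneous Type-I lumps of SOME profile is known). -/
theorem stub_weakL3Selection :
    ∀ C : ℝ,
      (∃ (u : ℝ → E³ → E³) (p : ℝ → E³ → ℝ) (G : ℝ → E³ → E³ →L[ℝ] E³),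
        IsSuitableWeakSolutionOn 𝕊 1 0 u p ∧ HasWeakSpatialGradientOn 𝕊 u G ∧
        typeIBound (Iio (0 : ℝ) ×ˢ univ) u p G < ⊤ ∧ HasTypeITimeDecay C u ∧
        IsBackwardSingularPoint u 0) →
      ∃ (C₁ M : ℝ) (u : ℝ → E³ → E³) (p : ℝ → E³ → ℝ) (G : ℝ → E³ → E³ →L[ℝ] E³),
        IsSuitableWeakSolutionOn 𝕊 1 0 u p ∧ HasWeakSpatialGradientOn 𝕊 u G ∧
        typeIBound (Iio (0 : ℝ) ×ˢ univ) u p G < ⊤ ∧ HasTypeITimeDecay C₁ u ∧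
        IsBackwardSingularPoint u 0 ∧
        ∀ t : ℝ, t < 0 → ∀ h : ℝ, 0 < h →
          ENNReal.ofReal (h ^ 3) * volume {x : E³ | h < ‖u t x‖} ≤ ENNReal.ofReal M := by
  sorry

/-! ### The crux -/

/-- **`RellichScar.ApexLocalisation` from the bet**: `stub_rdCruxIffWeakL3Selection.2` (the doll theorem)
applied to `stub_weakL3Selection`. -/
theorem ApexLocalisation_of :
    Summit.NavierStokesRegularity.NavierStokesRegularity.Theses.RellichScar.ApexLocalisation :=
  stub_rdCruxIffWeakL3Selection.2 stub_weakL3Selection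

end Summit.NavierStokesRegularity.NavierStokesRegularity.Theorems.RellichScarApexLocalisation

end
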